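import Mathlib
import Literature.Computability.AlgebraicComplexity.OrbitClosure
import Literature.Computability.AlgebraicComplexity.StandardFamilies
import Summits.ValiantsHypothesis.ValiantsHypothesis.Theorems.BorderApolarityFixedWitnessObstructionQPUnpad

/-!
# Border apolarity, crux `ToricWitnessObstructionQP` — stub `stub_pencilOfNormalForm` (S5, the pencil)

Route `ValiantsHypothesis/BorderApolarity`, crux item `stmt-ValiantsHypothesis-14753`, line `Sketch`,
stub `stub_pencilOfNormalForm`.  Specialising an extremal toric representation
`pp = wHC_w^e (g · det_m)` of the padded permanent `pp = X₀₀ ^ (m - n) · per_n` with block-additive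
weights at `X₀₀ ↦ 1`, block variable `(i, j) ↦ X (ε i, ε j)` (`ε : BlockIdx n m ≃ Fin n`), every other
variable `↦ 0`, exhibits `per_n` as the top `s`-coefficient of the determinant of the `m × m` pencil
`s ^ (w (0,0)) G₀ + Σ_{ij} s ^ (γ i j) X_{ij} G_{ij}` read off from the linear forms of `g`, with
`deg_s det ≤ e` and `γ = w|_block` exchange-additive.

Proof.  The torus generating map `T_a : X_v ↦ s ^ (w v) · a v` (an algebra map into `R[s]`) satisfies
`[s^j] T_a F = a^* (wHC_w^j F)` (checked on monomials); `g · det_m = det (L)` for the matrix `L` of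
linear forms `L_ab = Σ_v g v (a,b) X_v` (`AlgHom.map_det`), so `T_a (g · det_m)` is the determinant
of the pencil `T_a L`; the coefficient of `s ^ e` is `a^* pp = per_n` (as in `stub_unpad`) and the
coefficients above `e` vanish by extremality.
-/

open MvPolynomial
open scoped BigOperators Matrix
open Literature.Computability.AlgebraicComplexity

-- the mandated summit-side namespace repeats a component by design (single-problem summit)
set_option linter.dupNamespace false

namespace Summit.ValiantsHypothesis.ValiantsHypothesis.Theorems.BorderApolarityToricWitnessObstructionQP

open Summit.ValiantsHypothesis.ValiantsHypothesis.Theorems.BorderApolarityFixedWitnessObstructionQP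
  (rename_prodMap_perPoly)

/-- **Torus generating map on a monomial.**  The algebra map `X_v ↦ s ^ (w v) · a v` sends the
monomial `c · X ^ d` to `s ^ (weight_w d) · a^*(c · X ^ d)`. [folklore] -/
theorem aeval_monomial_pow_weight {k σ S : Type*} [CommSemiring k] [CommSemiring S] [Algebra k S]
    (w : σ → ℕ) (a : σ → S) (d : σ →₀ ℕ) (c : k) :
    aeval (fun v => Polynomial.monomial (w v) (a v)) (monomial d c) =
      Polynomial.monomial (Finsupp.weight w d) (aeval a (monomial d c)) := by
  induction d using Finsupp.induction with
  | zero =>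
    rw [← C_apply, algHom_C, algHom_C, map_zero, Polynomial.monomial_zero_left,
      Polynomial.algebraMap_apply]
  | single_add v i d _ _ ih =>
    rw [monomial_single_add, map_mul, map_mul, map_pow, map_pow, aeval_X, aeval_X, ih, map_add,
      Finsupp.weight_single, Polynomial.monomial_pow, Polynomial.monomial_mul_monomial, smul_eq_mul,
      mul_comm (w v) i]

/-- **Torus generating function = generating function of the weighted components.**  For the
algebra map `T_a : X_v ↦ s ^ (w v) · a v` into `S[s]`, the coefficient of `s ^ j` in `T_a F` is the
specialisation `a^*` of the `w`-weighted homogeneous component of `F` of weight `j`. [folklore] -/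
theorem coeff_aeval_monomial_pow_weight {k σ S : Type*} [CommSemiring k] [CommSemiring S]
    [Algebra k S] (w : σ → ℕ) (a : σ → S) (F : MvPolynomial σ k) (j : ℕ) :
    (aeval (fun v => Polynomial.monomial (w v) (a v)) F).coeff j =
      aeval a (weightedHomogeneousComponent w j F) := by
  induction F using MvPolynomial.induction_on' with
  | monomial d c =>
    rw [aeval_monomial_pow_weight, Polynomial.coeff_monomial]
    by_cases h : Finsupp.weight w d = j
    · rw [if_pos h, (isWeightedHomogeneous_monomial w d c h).weightedHomogeneousComponent_same]
    · rw [if_neg h, (isWeightedHomogeneous_monomial w d c rfl).weightedHomogeneousComponent_ne j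
        (Ne.symm h), map_zero]
  | add p q hp hq => rw [map_add, Polynomial.coeff_add, hp, hq, map_add, map_add]

/-- **The specialisation kills the padding.**  Under "block variable `(i, j) ↦ X (ε i, ε j)`,
`X₀₀ ↦ 1`, every other variable `↦ 0`" the padded permanent `X₀₀ ^ (m - n) · per_n` becomes
`perPoly (Fin n) ℂ` (cf. `stub_unpad`). [folklore] -/
theorem aeval_blockSpec_paddedPerPoly (n m : ℕ) [NeZero m] (ε : BlockIdx n m ≃ Fin n)
    (aa : Fin m × Fin m → MvPolynomial (Fin n × Fin n) ℂ)
    (haa : ∀ v, aa v = if h : m - n ≤ (v.1 : ℕ) ∧ m - n ≤ (v.2 : ℕ) then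
      X (ε ⟨v.1, h.1⟩, ε ⟨v.2, h.2⟩) else if v = (0, 0) then 1 else 0) :
    aeval aa (paddedPerPoly ℂ n m) = perPoly (Fin n) ℂ := by
  -- the padding factor is sent to `1`
  have h00 : aa (0, 0) ^ (m - n) = 1 := by
    rcases Nat.eq_zero_or_pos (m - n) with h0 | hpos
    · rw [h0, pow_zero]
    · have h : ¬ (m - n ≤ (((0, 0) : Fin m × Fin m).1 : ℕ) ∧
          m - n ≤ (((0, 0) : Fin m × Fin m).2 : ℕ)) := by
        simp only [Fin.val_zero, Nat.le_zero, and_self]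
        omega
      rw [haa, dif_neg h, if_pos rfl, one_pow]
  -- on the block the substitution is the renaming along `Prod.map ε ε`
  have hcomp : (aa ∘ fun ij : BlockIdx n m × BlockIdx n m => ((ij.1 : Fin m), (ij.2 : Fin m))) =
      X ∘ Prod.map ε ε := by
    funext ij
    obtain ⟨i, j⟩ := ij
    simp only [Function.comp_apply, Prod.map_apply, haa, dif_pos (And.intro i.2 j.2),
      Subtype.coe_eta]
  rw [paddedPerPoly, map_mul, map_pow, aeval_X, h00, one_mul, aeval_rename, hcomp,
    ← rename_eq_aeval, rename_prodMap_perPoly]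

/-- **Entries of the specialised pencil.**  The specialisation of the torus-scaled linear form
`Σ_v g v (a,b) s ^ (w v) X_v` is `s ^ (w (0,0)) g (0,0) (a,b) + Σ_{block v} s ^ (w v) g v (a,b) X_{ε v}`
(the first term only when `(0,0)` is off the block, i.e. `n < m`), with the block sum re-indexed by
`Fin n × Fin n` through `ε`. [folklore] -/
theorem sum_smul_monomial_blockSpec (n m : ℕ) [NeZero m] (ε : BlockIdx n m ≃ Fin n)
    (w : Fin m × Fin m → ℕ) (g : Matrix (Fin m × Fin m) (Fin m × Fin m) ℂ)
    (aa : Fin m × Fin m → MvPolynomial (Fin n × Fin n) ℂ)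
    (haa : ∀ v, aa v = if h : m - n ≤ (v.1 : ℕ) ∧ m - n ≤ (v.2 : ℕ) then
      X (ε ⟨v.1, h.1⟩, ε ⟨v.2, h.2⟩) else if v = (0, 0) then 1 else 0) (a b : Fin m) :
    ∑ v, g v (a, b) • Polynomial.monomial (w v) (aa v) =
      Polynomial.monomial (w (0, 0)) (C (if n < m then g (0, 0) (a, b) else 0)) +
      ∑ i : Fin n, ∑ j : Fin n, Polynomial.monomial (w ((ε.symm i : Fin m), (ε.symm j : Fin m)))
        (C (g ((ε.symm i : Fin m), (ε.symm j : Fin m)) (a, b)) * X (i, j)) := by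
  rw [← Finset.sum_filter_add_sum_filter_not Finset.univ
    (fun v : Fin m × Fin m => m - n ≤ (v.1 : ℕ) ∧ m - n ≤ (v.2 : ℕ)), add_comm]
  congr 1
  · -- off the block only `(0,0)` survives, and only when `n < m`
    by_cases hlt : n < m
    · rw [if_pos hlt]
      have h0 : ¬ (m - n ≤ (((0, 0) : Fin m × Fin m).1 : ℕ) ∧
          m - n ≤ (((0, 0) : Fin m × Fin m).2 : ℕ)) := by
        simp only [Fin.val_zero, Nat.le_zero, and_self]
        omega
      rw [Finset.sum_eq_single_of_mem ((0, 0) : Fin m × Fin m)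
        (Finset.mem_filter.2 ⟨Finset.mem_univ _, h0⟩)]
      · rw [haa, dif_neg h0, if_pos rfl, Polynomial.smul_monomial, smul_eq_C_mul, mul_one]
      · intro v hv hne
        rw [Finset.mem_filter] at hv
        rw [haa, dif_neg hv.2, if_neg hne, Polynomial.monomial_zero_right, smul_zero]
    · rw [if_neg hlt, map_zero, Polynomial.monomial_zero_right]
      refine Finset.sum_eq_zero fun v hv => ?_
      rw [Finset.mem_filter] at hv
      exact absurd ⟨by omega, by omega⟩ hv.2
  · -- on the block, re-index through `ε`
    rw [Finset.sum_subtype (F := inferInstance) (Finset.univ.filter fun v : Fin m × Fin m =>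
        m - n ≤ (v.1 : ℕ) ∧ m - n ≤ (v.2 : ℕ))
        (p := fun v : Fin m × Fin m => m - n ≤ (v.1 : ℕ) ∧ m - n ≤ (v.2 : ℕ)) (by simp),
      ← Fintype.sum_prod_type']
    refine Fintype.sum_equiv ((Equiv.subtypeProdEquivProd (p := fun i : Fin m => m - n ≤ (i : ℕ))
      (q := fun i : Fin m => m - n ≤ (i : ℕ))).trans (ε.prodCongr ε)) _ _ fun x => ?_
    rw [haa, dif_pos x.2]
    simp only [Equiv.trans_apply, Equiv.prodCongr_apply, Prod.map_fst, Prod.map_snd,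
      Equiv.subtypeProdEquivProd, Equiv.coe_fn_mk, Equiv.symm_apply_apply, Prod.mk.eta,
      Polynomial.smul_monomial, smul_eq_C_mul]

/-- **The specialised torus image of `g · det_m` is the determinant of the pencil.**  With
`a₀ = w (0,0)`, `γ = w|_block`, `G₀ = g (0,0)` (or `0` when `n = m`) and `G i j = g (block (i,j))`
read through `ε`, the determinant of `s ^ a₀ G₀ + Σ_{ij} s ^ (γ i j) X_{ij} G_{ij}` equals
`T_aa (g · det_m)` for the torus generating map `T_aa : X_v ↦ s ^ (w v) · aa v`. [folklore] -/
theorem det_pencil_eq_aeval (n m : ℕ) [NeZero m] (ε : BlockIdx n m ≃ Fin n)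
    (w : Fin m × Fin m → ℕ) (g : Matrix (Fin m × Fin m) (Fin m × Fin m) ℂ)
    (aa : Fin m × Fin m → MvPolynomial (Fin n × Fin n) ℂ)
    (haa : ∀ v, aa v = if h : m - n ≤ (v.1 : ℕ) ∧ m - n ≤ (v.2 : ℕ) then
      X (ε ⟨v.1, h.1⟩, ε ⟨v.2, h.2⟩) else if v = (0, 0) then 1 else 0)
    (a₀ : ℕ) (γ : Fin n → Fin n → ℕ) (G₀ : Matrix (Fin m) (Fin m) ℂ)
    (G : Fin n → Fin n → Matrix (Fin m) (Fin m) ℂ) (ha₀ : a₀ = w (0, 0))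
    (hγ : ∀ i j, γ i j = w ((ε.symm i : Fin m), (ε.symm j : Fin m)))
    (hG₀ : ∀ a b, G₀ a b = if n < m then g (0, 0) (a, b) else 0)
    (hG : ∀ i j a b, G i j a b = g ((ε.symm i : Fin m), (ε.symm j : Fin m)) (a, b)) :
    (Matrix.of fun a b : Fin m => Polynomial.monomial a₀ (C (G₀ a b)) +
        ∑ i : Fin n, ∑ j : Fin n, Polynomial.monomial (γ i j) (C (G i j a b) * X (i, j)) :
          Matrix (Fin m) (Fin m) (Polynomial (MvPolynomial (Fin n × Fin n) ℂ))).det =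
      aeval (fun v => Polynomial.monomial (w v) (aa v))
        (linSubst (Fin m × Fin m) ℂ g (detPoly (Fin m) ℂ)) := by
  subst ha₀
  set A : Matrix (Fin m) (Fin m) (Polynomial (MvPolynomial (Fin n × Fin n) ℂ)) :=
    (Matrix.of fun a b : Fin m => Polynomial.monomial (w (0, 0)) (C (G₀ a b)) +
        ∑ i : Fin n, ∑ j : Fin n, Polynomial.monomial (γ i j) (C (G i j a b) * X (i, j)) :
          Matrix (Fin m) (Fin m) (Polynomial (MvPolynomial (Fin n × Fin n) ℂ))) with hA
  have hcomp : (aeval (fun v => Polynomial.monomial (w v) (aa v)) :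
      MvPolynomial (Fin m × Fin m) ℂ →ₐ[ℂ] Polynomial (MvPolynomial (Fin n × Fin n) ℂ)).comp
        (linSubst (Fin m × Fin m) ℂ g) = aeval (fun p : Fin m × Fin m => A p.1 p.2) := by
    refine MvPolynomial.algHom_ext fun v => ?_
    obtain ⟨a, b⟩ := v
    simp only [AlgHom.comp_apply, aeval_X, linSubst_X, map_sum, map_smul]
    rw [sum_smul_monomial_blockSpec n m ε w g aa haa a b, hA, Matrix.of_apply]
    simp only [hγ, hG₀, hG]
  symm
  rw [← AlgHom.comp_apply, hcomp, detPoly, AlgHom.map_det, Matrix.mvPolynomialX_mapMatrix_aeval]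

/-- **S5 (specialisation `ℓ = 1, z = 0`: normal form ⇒ torus leading form).** An extremal toric
representation `pp = wHC_w^e (g · det_m)` with `u = 1` and block-additive weights yields
`TLF(n,m)`: `per_n = [s^e'] det (s^{a₀} G₀ + Σ_{ij} s^{γ_ij} Y_ij G_ij)` with `deg_s det ≤ e'` and `γ`
exchange-additive (read off `G₀`, `G_ij` as the coefficient matrices of the linear forms of `g` at
`X₀₀` and at the block variables, `a₀ = w(0,0)`, `γ = w|_block`). [folklore] -/
theorem stub_pencilOfNormalForm : ∀ (n m : ℕ) [NeZero m], 3 ≤ n → n ≤ m →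
    ∀ (g : GL (Fin m × Fin m) ℂ) (w : Fin m × Fin m → ℕ) (e : ℕ),
    (∀ d ∈ (linSubst (Fin m × Fin m) ℂ (g : Matrix (Fin m × Fin m) (Fin m × Fin m) ℂ)
      (detPoly (Fin m) ℂ)).support, Finsupp.weight w d ≤ e) →
    paddedPerPoly ℂ n m = weightedHomogeneousComponent w e
      (linSubst (Fin m × Fin m) ℂ (g : Matrix (Fin m × Fin m) (Fin m × Fin m) ℂ) (detPoly (Fin m) ℂ)) →
    (∀ i j k l : Fin m, m - n ≤ (i : ℕ) → m - n ≤ (k : ℕ) → m - n ≤ (j : ℕ) → m - n ≤ (l : ℕ) →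
      w (i, j) + w (k, l) = w (i, l) + w (k, j)) →
    ∃ (e' a₀ : ℕ) (γ : Fin n → Fin n → ℕ) (G₀ : Matrix (Fin m) (Fin m) ℂ)
      (G : Fin n → Fin n → Matrix (Fin m) (Fin m) ℂ),
      (∀ i j k l : Fin n, γ i j + γ k l = γ i l + γ k j) ∧
      (Matrix.of fun a b : Fin m => Polynomial.monomial a₀ (C (G₀ a b)) +
        ∑ i : Fin n, ∑ j : Fin n, Polynomial.monomial (γ i j) (C (G i j a b) * X (i, j)) :
          Matrix (Fin m) (Fin m) (Polynomial (MvPolynomial (Fin n × Fin n) ℂ))).det.natDegree ≤ e' ∧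
      (Matrix.of fun a b : Fin m => Polynomial.monomial a₀ (C (G₀ a b)) +
        ∑ i : Fin n, ∑ j : Fin n, Polynomial.monomial (γ i j) (C (G i j a b) * X (i, j)) :
          Matrix (Fin m) (Fin m) (Polynomial (MvPolynomial (Fin n × Fin n) ℂ))).det.coeff e' =
        perPoly (Fin n) ℂ := by
  intro n m _ _h3 hnm g w e hext hpp hadd
  -- a bijection between the block indices and `Fin n`
  obtain ⟨ε⟩ : Nonempty (BlockIdx n m ≃ Fin n) := ⟨Fintype.equivFinOfCardEq (card_blockIdx hnm)⟩
  -- the specialisation: block variables to the variables of `per_n`, `X₀₀ ↦ 1`, the rest `↦ 0`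
  obtain ⟨aa, haa⟩ : ∃ aa : Fin m × Fin m → MvPolynomial (Fin n × Fin n) ℂ, ∀ v, aa v =
      if h : m - n ≤ (v.1 : ℕ) ∧ m - n ≤ (v.2 : ℕ) then X (ε ⟨v.1, h.1⟩, ε ⟨v.2, h.2⟩)
      else if v = (0, 0) then 1 else 0 := ⟨_, fun v => rfl⟩
  -- the data of the pencil, read off `g` and `w` through `ε`
  obtain ⟨γ, hγ⟩ : ∃ γ : Fin n → Fin n → ℕ, ∀ i j, γ i j = w ((ε.symm i : Fin m), (ε.symm j : Fin m)) :=
    ⟨_, fun i j => rfl⟩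
  obtain ⟨G₀, hG₀⟩ : ∃ G₀ : Matrix (Fin m) (Fin m) ℂ, ∀ a b, G₀ a b =
      if n < m then (g : Matrix (Fin m × Fin m) (Fin m × Fin m) ℂ) (0, 0) (a, b) else 0 :=
    ⟨Matrix.of fun a b => if n < m then (g : Matrix (Fin m × Fin m) (Fin m × Fin m) ℂ) (0, 0) (a, b)
      else 0, fun a b => rfl⟩
  obtain ⟨G, hG⟩ : ∃ G : Fin n → Fin n → Matrix (Fin m) (Fin m) ℂ, ∀ i j a b, G i j a b =
      (g : Matrix (Fin m × Fin m) (Fin m × Fin m) ℂ) ((ε.symm i : Fin m), (ε.symm j : Fin m)) (a, b) :=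
    ⟨fun i j => Matrix.of fun a b =>
      (g : Matrix (Fin m × Fin m) (Fin m × Fin m) ℂ) ((ε.symm i : Fin m), (ε.symm j : Fin m)) (a, b),
      fun i j a b => rfl⟩
  have key := det_pencil_eq_aeval n m ε w (g : Matrix (Fin m × Fin m) (Fin m × Fin m) ℂ) aa haa
    (w (0, 0)) γ G₀ G rfl hγ hG₀ hG
  refine ⟨e, w (0, 0), γ, G₀, G, ?_, ?_, ?_⟩
  · -- exchange-additivity of `γ` from block-additivity of `w`
    intro i j k l
    rw [hγ, hγ, hγ, hγ]
    exact hadd _ _ _ _ (ε.symm i).2 (ε.symm k).2 (ε.symm j).2 (ε.symm l).2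
  · -- no `s`-degree above `e`, by extremality
    rw [key, Polynomial.natDegree_le_iff_coeff_eq_zero]
    intro N hN
    rw [coeff_aeval_monomial_pow_weight, weightedHomogeneousComponent_eq_zero', map_zero]
    intro d hd
    exact (lt_of_le_of_lt (hext d hd) hN).ne
  · -- the coefficient of `s ^ e` is the specialised padded permanent, i.e. `per_n`
    rw [key, coeff_aeval_monomial_pow_weight, ← hpp, aeval_blockSpec_paddedPerPoly n m ε aa haa]

end Summit.ValiantsHypothesis.ValiantsHypothesis.Theorems.BorderApolarityToricWitnessObstructionQP
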